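import Summits.QuantumAdvantage.QuantumAdvantage.Theses.RingFrame
import Summits.QuantumAdvantage.AdviceFreeQNC0.WindowLadderPolylogBlocks
import Summits.QuantumAdvantage.AdviceFreeQNC0.WalkTransport
import HarnessLib

/-!
# Route RingFrame, crux α `RingToElim` (stmt-QuantumAdvantage-19119): the window ladder read on
# the RING — cycle-HLF strategies deviating from the canonical guess in boundedly many windows fail

Support theorem for the crux item α, in the language of the rung leaf `RingHard 2` itself
(`Literature…RingHLF.Rel`, the graph-state relation of the `(n+1)`-cycle).  The transport of
`WalkTransport.lean` (`rel_iff_ringWinU`: on the odd class, `Rel x z(x)` iff the walk strategy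
`y_g(u) = z_g(xOfU u) ⊕ t_g(xOfU u)` wins the walk game at charge `n + 2` at `u = uVec x`;
`t = tGuess` the canonical affine guess `t(x)_j = x_j ⊕ x_{j+1}` of `RingCanonical.lean`) sends a
ring strategy that AGREES WITH THE CANONICAL GUESS outside a set of positions to a walk strategy
SUPPORTED on that set.  Hence the cell's `t`-window theorem (`ringWinU_windows_polylog_le`,
`WindowLadderPolylogBlocks.lean`, engine `multiElimHard`) gives:

* `ringRel_windowDeviation_le`: for every `t` there is `θ < 1` such that for every `C`, all large
  `n` and all block lengths `l = [L₀, …, L_t]` with `Σ l = n`, `L_i ≥ (log₂ n)^{4C+4}`: every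
  tuple `P` of `𝔽₂`-polynomials of degree `≤ (log₂ (n+1))^C` on the `(n+1)`-cycle whose output
  bits `[P_g(x) = 1]` coincide with the canonical guess `t(x)_g` at every position `g` with
  `g + K ≤ n` outside the windows `[P_j, P_j + K)` (`P_j = L₀ + ⋯ + L_{j−1}`, `j ≤ t`,
  `K ≤ (log₂ n)^C`) satisfies `Rel x (P x)` for at most `θ·2^{n+1}` patterns `x`;
* `ringRel_baseDeviation_le`: the case `t = 0` without lists — deviating from the canonical
  guess only within distance `(log₂ n)^C` of the base point of the cycle does not help.

So a classical polylog-degree device that improves on the canonical affine guess (which is right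
exactly on the even class, `rel_tGuess_iff`) only inside a FIXED number of polylog arcs of the
cycle (one of them around the base point) still fails on at least a `(1 − θ)`-fraction of
the patterns — the ring-side reading of "boundedly many interior clusters do not help".

The cell's statement (prover; a special case of crux α of route RingFrame); not in print.
WHAT THIS IS NOT: not `RingHard 2` / α — the number of arcs is fixed (`θ_t → 1` as `t → ∞`) and
general strategies deviate from `t` everywhere; nothing on `LDMAPolylog`, `TRPlus`; no separation.
-/

-- the sub-problem namespace `Summit.QuantumAdvantage.QuantumAdvantage` repeats the summit name by design (D-0017)
set_option linter.dupNamespace false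

noncomputable section

namespace Summit.QuantumAdvantage.QuantumAdvantage.Theorems

open Finset Summit.QuantumAdvantage.AdviceFreeQNC0
open Literature.Computability.QuantumComplexity Literature.Computability.QuantumComplexity.RingHLF
open Literature.Computability.MetaComplexity Literature.Computability.MetaComplexity.Smolensky

/-- Degree bookkeeping of the transport (as in `WalkTransport.lean`): `(log₂ (n+1))^c ≤
(log₂ n)^(2c+1)` and `1 ≤ (log₂ n)^(2c+1)` for `n ≥ 4`. [folklore] -/
theorem transport_degree_le {n : ℕ} (hn : 4 ≤ n) (c : ℕ) :
    (Nat.log 2 (n + 1)) ^ c ≤ (Nat.log 2 n) ^ (2 * c + 1) ∧ 1 ≤ (Nat.log 2 n) ^ (2 * c + 1) := by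
  have hlog : 2 ≤ Nat.log 2 n := Nat.le_log_of_pow_le (by norm_num) (by omega)
  have hsucc : Nat.log 2 (n + 1) ≤ Nat.log 2 n + 1 := by
    have h : n + 1 ≤ 2 ^ (Nat.log 2 n + 1) := Nat.lt_pow_succ_log_self (by norm_num) n
    calc Nat.log 2 (n + 1) ≤ Nat.log 2 (2 ^ (Nat.log 2 n + 1)) := Nat.log_mono_right h
      _ = Nat.log 2 n + 1 := Nat.log_pow (by norm_num) _
  have h1 : Nat.log 2 (n + 1) ≤ Nat.log 2 n * Nat.log 2 n := by nlinarith
  constructor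
  · calc (Nat.log 2 (n + 1)) ^ c ≤ (Nat.log 2 n * Nat.log 2 n) ^ c := Nat.pow_le_pow_left h1 c
      _ = (Nat.log 2 n) ^ (2 * c) := by rw [← pow_two, ← pow_mul]
      _ ≤ (Nat.log 2 n) ^ (2 * c + 1) := Nat.pow_le_pow_right (by omega) (by omega)
  · exact Nat.one_le_pow _ _ (by omega)

/-- **Cycle-HLF strategies deviating from the canonical guess only in `t + 1` polylog arcs fail
on a constant fraction.**  For every `t` there is `θ < 1` such that for every `C`, all large `n`
and every list `l` of `t + 1` block lengths `≥ (log₂ n)^{4C+4}` with `Σ l = n`, every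
`K ≤ (log₂ n)^C` and every tuple `P` of `𝔽₂`-polynomials on `{0,1}^{n+1}` of degree
`≤ (log₂ (n+1))^C`: if `[P_g(x) = 1] = t(x)_g` (the canonical guess `tGuess`) for every position
`g` with `g + K ≤ n` outside the windows `[P_j, P_j + K)`, `P_j = (l.take j).sum`, `j ≤ t`, then
`RingHLF.Rel x (P x)` holds for at most `θ·2^{n+1}` patterns `x`.  (Cell statement; transport
`rel_iff_ringWinU` of the walk theorem `ringWinU_windows_polylog_le` at `C' = 2C + 1`, the even
class costing at most `2ⁿ`; support for crux α `RingToElim`.) [cite: Srinivasan2023, Lemma 3.1] -/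
theorem ringRel_windowDeviation_le :
    ∀ t : ℕ, ∃ θ : ℝ, θ < 1 ∧ ∀ C : ℕ, ∃ n₀ : ℕ, ∀ l : List ℕ, l.length = t + 1 →
      n₀ ≤ l.sum → (∀ L ∈ l, (Nat.log 2 l.sum) ^ (4 * C + 4) ≤ L) →
      ∀ K : ℕ, K ≤ (Nat.log 2 l.sum) ^ C →
      ∀ P : Fin (l.sum + 1) → CubeFn (ZMod 2) (l.sum + 1),
        (∀ i, P i ∈ lowDeg (ZMod 2) (l.sum + 1) ((Nat.log 2 (l.sum + 1)) ^ C)) →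
        (∀ g : Fin (l.sum + 1),
            (∀ j < l.length, g.val < (l.take j).sum ∨ (l.take j).sum + K ≤ g.val) →
            g.val + K ≤ l.sum → ∀ x, decide (P g x = 1) = tGuess x g) →
          ((univ.filter fun x : Fin (l.sum + 1) → Bool =>
              Rel x (fun i => decide (P i x = 1))).card : ℝ) ≤ θ * (2 : ℝ) ^ (l.sum + 1) := by
  intro t
  classical
  obtain ⟨θ', hθ', hW⟩ := ringWinU_windows_polylog_le t
  refine ⟨(1 + θ') / 2, by linarith, fun C => ?_⟩
  obtain ⟨n₀, hn₀⟩ := hW (2 * C + 1)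
  refine ⟨max n₀ 4, fun l hl hn hblk K hK P hP hdev => ?_⟩
  have hn₀n : n₀ ≤ l.sum := le_trans (le_max_left _ _) hn
  have hn4 : 4 ≤ l.sum := le_trans (le_max_right _ _) hn
  -- the transported walk strategy, its degree and its support
  set z : (Fin (l.sum + 1) → Bool) → (Fin (l.sum + 1) → Bool) := fun x i => decide (P i x = 1)
    with hz
  set y : Fin (l.sum + 1) → (Fin l.sum → Bool) → Bool :=
    fun g u => xor (z (xOfU u) g) (tGuess (xOfU u) g) with hy
  obtain ⟨hdegle, hone⟩ := transport_degree_le hn4 C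
  have hdeg : ∀ g, HasDeg (y g) ((Nat.log 2 l.sum) ^ (2 * C + 1)) := fun g =>
    hasDeg_transport hone (P g) (lowDeg_mono hdegle (hP g)) g
  have hsupp : ∀ g : Fin (l.sum + 1),
      (∀ j < l.length, g.val < (l.take j).sum ∨ (l.take j).sum + K ≤ g.val) →
      g.val + K ≤ l.sum → ∀ u, y g u = false := by
    intro g hg hgK u
    simp only [hy, hz, hdev g hg hgK (xOfU u), Bool.xor_self]
  have hblk' : ∀ L ∈ l, (Nat.log 2 l.sum) ^ (2 * (2 * C + 1) + 2) ≤ L := by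
    intro L hL
    rw [show 2 * (2 * C + 1) + 2 = 4 * C + 4 by ring]
    exact hblk L hL
  have hK' : K ≤ (Nat.log 2 l.sum) ^ (2 * C + 1) := by
    have hlog : 1 ≤ Nat.log 2 l.sum := Nat.le_log_of_pow_le (by norm_num) (by omega)
    exact hK.trans (Nat.pow_le_pow_right hlog (by omega))
  have hwin := hn₀ l hl hn₀n hblk' K hK' (l.sum + 2) y hdeg hsupp
  -- split the solved patterns by the parity of the number of zeros
  set Sx := univ.filter fun x : Fin (l.sum + 1) → Bool => Rel x (z x) with hSx
  set OddZ : (Fin (l.sum + 1) → Bool) → Prop := fun x =>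
    (univ.filter fun j : Fin (l.sum + 1) => x j = false).card % 2 = 1 with hOddZ
  have hsplit : Sx.card = (Sx.filter OddZ).card + (Sx.filter fun x => ¬ OddZ x).card :=
    (Finset.card_filter_add_card_filter_not _).symm
  have heven : (Sx.filter fun x => ¬ OddZ x).card ≤ 2 ^ l.sum := by
    refine le_trans (Finset.card_le_card ?_) card_even_class_le
    intro x hx
    rw [mem_filter] at hx ⊢
    exact ⟨mem_univ _, hx.2⟩
  have hodd : (Sx.filter OddZ).card ≤
      (univ.filter fun u : Fin l.sum → Bool => ringWinU (l.sum + 2) y u = true).card := by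
    refine Finset.card_le_card_of_injOn uVec ?_ ?_
    · intro x hx
      rw [Finset.mem_coe, mem_filter, hSx, mem_filter] at hx
      rw [Finset.mem_coe, mem_filter]
      exact ⟨mem_univ _, (rel_iff_ringWinU (by omega) x hx.2 z).1 hx.1.2⟩
    · intro x₁ hx₁ x₂ hx₂ h
      rw [Finset.mem_coe, mem_filter] at hx₁ hx₂
      rw [← xOfU_uVec (by omega) x₁ hx₁.2, ← xOfU_uVec (by omega) x₂ hx₂.2, h]
  -- arithmetic
  have hS : (Sx.card : ℝ) ≤ 2 ^ l.sum + θ' * 2 ^ l.sum := by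
    have h1 : (Sx.card : ℝ) ≤
        ((Sx.filter fun x => ¬ OddZ x).card : ℝ) + ((Sx.filter OddZ).card : ℝ) := by
      rw [hsplit]; push_cast; linarith
    have h2 : ((Sx.filter fun x => ¬ OddZ x).card : ℝ) ≤ 2 ^ l.sum := by exact_mod_cast heven
    have h3 : ((Sx.filter OddZ).card : ℝ) ≤ θ' * 2 ^ l.sum :=
      le_trans (by exact_mod_cast hodd) hwin
    linarith
  have hpow : (2 : ℝ) ^ (l.sum + 1) = 2 * 2 ^ l.sum := by ring
  calc (Sx.card : ℝ) ≤ 2 ^ l.sum + θ' * 2 ^ l.sum := hS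
    _ = (1 + θ') / 2 * (2 : ℝ) ^ (l.sum + 1) := by rw [hpow]; ring

/-- **Deviating from the canonical guess only near the base point does not help.**  There is
`θ < 1` such that for every `C`, all large `n`, every `K ≤ (log₂ n)^C` and every tuple `P` of
`𝔽₂`-polynomials on `{0,1}^{n+1}` of degree `≤ (log₂ (n+1))^C` that agrees with the canonical
guess `tGuess` at every position `g` with `K ≤ g ≤ n − K` (i.e. deviates from it only within
distance `K` of the base point of the cycle): `RingHLF.Rel x (P x)` holds for at most
`θ·2^{n+1}` patterns.  (The case `t = 0` of `ringRel_windowDeviation_le`, one block `[n]`; the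
ring-side form of `ringWinU_endSupported_le`.) [cite: Srinivasan2023, Lemma 3.1] -/
theorem ringRel_baseDeviation_le :
    ∃ θ : ℝ, θ < 1 ∧ ∀ C : ℕ, ∃ n₀ : ℕ, ∀ n ≥ n₀, ∀ K : ℕ, K ≤ (Nat.log 2 n) ^ C →
      ∀ P : Fin (n + 1) → CubeFn (ZMod 2) (n + 1),
        (∀ i, P i ∈ lowDeg (ZMod 2) (n + 1) ((Nat.log 2 (n + 1)) ^ C)) →
        (∀ g : Fin (n + 1), K ≤ g.val → g.val + K ≤ n → ∀ x, decide (P g x = 1) = tGuess x g) →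
          ((univ.filter fun x : Fin (n + 1) → Bool =>
              Rel x (fun i => decide (P i x = 1))).card : ℝ) ≤ θ * (2 : ℝ) ^ (n + 1) := by
  classical
  obtain ⟨θ, hθ, h⟩ := ringRel_windowDeviation_le 0
  refine ⟨θ, hθ, fun C => ?_⟩
  obtain ⟨n₀, hn₀⟩ := h C
  obtain ⟨n₁, hn₁⟩ := logPow_le_sqrt' (4 * C + 4) (c₀ := 1) one_pos
  refine ⟨max n₀ n₁, fun n hn K hK P hP hdev => ?_⟩
  have hn₀n : n₀ ≤ n := le_trans (le_max_left _ _) hn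
  have hn₁n : n₁ ≤ n := le_trans (le_max_right _ _) hn
  -- one block `[n]`: `[n].sum = n`, and the block is long enough for `n ≥ n₁`
  have hpow : (Nat.log 2 n) ^ (4 * C + 4) ≤ n := by
    have h1 := hn₁ n hn₁n
    have h2 : Real.sqrt n ≤ n :=
      (Real.sqrt_le_left (Nat.cast_nonneg n)).2 (by exact_mod_cast Nat.le_self_pow two_ne_zero n)
    have h3 : ((Nat.log 2 n ^ (4 * C + 4) : ℕ) : ℝ) ≤ (n : ℝ) := by linarith
    exact_mod_cast h3
  have hblk : ∀ L ∈ ([n] : List ℕ), (Nat.log 2 ([n] : List ℕ).sum) ^ (4 * C + 4) ≤ L := by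
    intro L hL
    rw [List.mem_singleton] at hL
    rw [hL, List.sum_singleton]
    exact hpow
  have hsum : ([n] : List ℕ).sum = n := List.sum_singleton
  have hdev' : ∀ g : Fin (([n] : List ℕ).sum + 1),
      (∀ j < ([n] : List ℕ).length,
        g.val < (([n] : List ℕ).take j).sum ∨ (([n] : List ℕ).take j).sum + K ≤ g.val) →
      g.val + K ≤ ([n] : List ℕ).sum → ∀ x, decide (P g x = 1) = tGuess x g := by
    intro g hg hgK x
    have h0 := hg 0 (by simp)
    simp only [List.take_zero, List.sum_nil, Nat.not_lt_zero, false_or, zero_add] at h0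
    exact hdev g h0 hgK x
  exact hn₀ [n] rfl hn₀n hblk K hK P hP hdev'

end Summit.QuantumAdvantage.QuantumAdvantage.Theorems
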